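import Literature.Analysis.FunctionSpaces.TorusAxisStepKernelMoment
import HarnessLib

/-!
# The commutator of the smoothed axis step multiplier with a Lipschitz function on `T^d`

Analysis/FunctionSpaces proof file (everything proved; no definitions, no named facts).  For the smoothed step
multiplier `Ψᵢ` along the axis `i` (`TorusAxisStepKernel`: coefficients `c k ↦ stepSym K Δ (kᵢ) · c k`, kernel
`stepKernel i K Δ`, first moment `M₁ ≤ 2/Δ` of `TorusAxisStepKernelMoment`) and a continuous `β : T^d → ℝ` with
`|β x − β y| ≤ Λ ‖reprc (x − y)‖`, the COMMUTATOR `[Ψᵢ, β]` is bounded on `L²` by `Λ · M₁`, here in the pairing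
form on real trigonometric polynomials `h = realTrigPoly S c`, `P = realTrigPoly S' c'`:

  `|∫ β ⟨h, Ψᵢ P⟩ − ∫ β ⟨Ψᵢ h, P⟩| ≤ (2Λ/Δ) ‖h‖₂ ‖P‖₂`      (`abs_axisStep_commutator_pairing_le`).

Proof (DiPerna–Lions' commutator lemma in its simplest form): `Ψᵢ` is convolution with the kernel along the axis
(`realTrigPoly_axisStep_eq_integral_sub/add`, from the orthogonality `∫ k(y) e^{∓2πi m yᵢ} dy = stepSym K Δ m`);
after Fubini and the translation `x ↦ x + yᵢ-spike` both pairings become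
`∫ k(y) ∫ β(·) ⟨h(x + yᵢ-spike), P(x)⟩`, with `β` evaluated at `x + yᵢ-spike` resp. `x`; the difference is bounded
by `Λ |reprc y _i|` times `‖h‖₂‖P‖₂` (Cauchy–Schwarz, translation invariance), and integrating against `|k(y)|` gives
`Λ · M₁`.  The constant involves the LIPSCHITZ constant of `β` only (no Wiener norm of its Fourier coefficients) and no
`log(K/Δ)`: summing over the axes bounds the commutator of the CUBE cut-off `Πᵢ Ψᵢ` (companion file).

Consumer: cell `ad-ideate`, K1L_D `stmt-AnomalousDissipation-27980`, W3-E (ii) `stub_effectiveFrameEnergyL_bandKill`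
(localised cube flux bound of the descent ladder, finding F-k3l-7).

## Mathlib / tree search
Tree: `TorusAxisStepKernel`, `TorusAxisStepKernelMoment`, `Torus.realTrigPoly` API (`integral_norm_sq_realTrigPoly`,
`IsConjSymm`), `Torus.reprc`.  Mathlib: `integral_integral_swap`, `integral_add_right_eq_self`,
`integral_mul_le_Lp_mul_Lq_of_nonneg` (Cauchy–Schwarz), `integral_inner`, `ContinuousLinearMap.integral_comp_comm`.

## References
* R. J. DiPerna, P.-L. Lions, Invent. Math. 98 (1989), §II.1 Lemma II.1. [`DiPernaLions1989`]
* L. Grafakos, *Classical Fourier Analysis*, 3rd ed., GTM 249 (2014), §3.1.3. [`Grafakos2014`]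
-/

noncomputable section

open MeasureTheory Set Filter Complex UnitAddTorus Function Finset
open scoped ENNReal InnerProductSpace ComplexConjugate

namespace Literature.Analysis.FunctionSpaces

namespace Torus

variable {d : Type*} [Fintype d] [DecidableEq d]

/-! ## §7 The commutator of the axis step multiplier with a Lipschitz function -/

section Commutator

open EuclideanSpace

omit [Fintype d] [DecidableEq d] in
/-- The smoothing preserves conjugate symmetry of coefficient families (the symbol is real and even).
[cite: Grafakos2014, §3.1.3] -/
theorem IsConjSymm.axisStep {c : (d → ℤ) → EuclideanSpace ℂ d} (hc : IsConjSymm c) (K Δ : ℕ) (i : d) :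
    IsConjSymm (fun k => ((stepSym K Δ (k i) : ℝ) : ℂ) • c k) := by
  intro k
  show ((stepSym K Δ ((-k) i) : ℝ) : ℂ) • c (-k) = conjVec (((stepSym K Δ (k i) : ℝ) : ℂ) • c k)
  rw [Pi.neg_apply, stepSym_neg, conjVec_smul, Complex.conj_ofReal, hc k]

/-- **The axis step multiplier is convolution with its kernel (complex form)**:
`Σ_{k∈S} e_k(x) σ(kᵢ) c_k = ∫ k(y) · Σ_{k∈S} e_k(x − yᵢ-spike) c_k dy`. [cite: Grafakos2014, §3.1.3] -/
theorem trigPoly_axisStep_eq_integral_sub {V : Type*} [NormedAddCommGroup V] [NormedSpace ℂ V] [CompleteSpace V]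
    (i : d) (K Δ : ℕ) (S : Finset (d → ℤ)) (c : (d → ℤ) → V) (x : UnitAddTorus d) :
    trigPoly S (fun k => ((stepSym K Δ (k i) : ℝ) : ℂ) • c k) x =
      ∫ y : UnitAddTorus d, (stepKernel i K Δ y : ℂ) • trigPoly S c (x - Pi.single i (y i)) := by
  simp_rw [trigPoly_apply, Finset.smul_sum]
  have hint : ∀ k : d → ℤ, Integrable (fun y : UnitAddTorus d =>
      (stepKernel i K Δ y : ℂ) • (mFourier k (x - Pi.single i (y i)) • c k)) volume := by
    intro k
    refine Continuous.integrable_of_hasCompactSupport ?_ (HasCompactSupport.of_compactSpace _)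
    refine (Complex.continuous_ofReal.comp (continuous_stepKernel i K Δ)).smul
      (((mFourier k).continuous.comp (continuous_const.sub ?_)).smul continuous_const)
    exact continuous_pi fun j => by
      by_cases hj : j = i
      · subst hj; simp only [Pi.single_eq_same]; exact continuous_apply j
      · simp only [Pi.single_eq_of_ne hj]; exact continuous_const
  rw [integral_finsetSum _ fun k _ => hint k]
  refine Finset.sum_congr rfl fun k _ => ?_
  simp_rw [mFourier_sub_pi_single, smul_smul, integral_smul_const]
  congr 1
  rw [show (fun y : UnitAddTorus d => (stepKernel i K Δ y : ℂ) * (mFourier k x * conj (mFourier (Pi.single i (k i)) y)))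
      = fun y => mFourier k x * ((stepKernel i K Δ y : ℂ) * conj (mFourier (Pi.single i (k i)) y)) by funext y; ring,
    integral_const_mul, integral_stepKernel_mul_conj_mFourier_single]

/-- The same with the opposite shift: `Σ_{k∈S} e_k(x) σ(kᵢ) c_k = ∫ k(y) · Σ_{k∈S} e_k(x + yᵢ-spike) c_k dy` (the symbol is even).
[cite: Grafakos2014, §3.1.3] -/
theorem trigPoly_axisStep_eq_integral_add {V : Type*} [NormedAddCommGroup V] [NormedSpace ℂ V] [CompleteSpace V]
    (i : d) (K Δ : ℕ) (S : Finset (d → ℤ)) (c : (d → ℤ) → V) (x : UnitAddTorus d) :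
    trigPoly S (fun k => ((stepSym K Δ (k i) : ℝ) : ℂ) • c k) x =
      ∫ y : UnitAddTorus d, (stepKernel i K Δ y : ℂ) • trigPoly S c (x + Pi.single i (y i)) := by
  simp_rw [trigPoly_apply, Finset.smul_sum]
  have hint : ∀ k : d → ℤ, Integrable (fun y : UnitAddTorus d =>
      (stepKernel i K Δ y : ℂ) • (mFourier k (x + Pi.single i (y i)) • c k)) volume := by
    intro k
    refine Continuous.integrable_of_hasCompactSupport ?_ (HasCompactSupport.of_compactSpace _)
    refine (Complex.continuous_ofReal.comp (continuous_stepKernel i K Δ)).smul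
      (((mFourier k).continuous.comp (continuous_const.add ?_)).smul continuous_const)
    exact continuous_pi fun j => by
      by_cases hj : j = i
      · subst hj; simp only [Pi.single_eq_same]; exact continuous_apply j
      · simp only [Pi.single_eq_of_ne hj]; exact continuous_const
  rw [integral_finsetSum _ fun k _ => hint k]
  refine Finset.sum_congr rfl fun k _ => ?_
  simp_rw [mFourier_add_pi_single, smul_smul, integral_smul_const]
  congr 1
  rw [show (fun y : UnitAddTorus d => (stepKernel i K Δ y : ℂ) * (mFourier k x * mFourier (Pi.single i (k i)) y))
      = fun y => mFourier k x * ((stepKernel i K Δ y : ℂ) * mFourier (Pi.single i (k i)) y) by funext y; ring,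
    integral_const_mul, integral_stepKernel_mul_mFourier_single]

omit [Fintype d] in
/-- The continuity of `y ↦ Pi.single i (y i)` on the torus. [folklore] -/
private theorem continuous_pi_single_apply (i : d) :
    Continuous fun y : UnitAddTorus d => (Pi.single i (y i) : UnitAddTorus d) :=
  continuous_pi fun j => by
    by_cases hj : j = i
    · subst hj; simp only [Pi.single_eq_same]; exact continuous_apply j
    · simp only [Pi.single_eq_of_ne hj]; exact continuous_const

/-- **The axis step multiplier on REAL trigonometric polynomials is convolution with the kernel** (shift `−`).
[cite: Grafakos2014, §3.1.3] -/
theorem realTrigPoly_axisStep_eq_integral_sub (i : d) (K Δ : ℕ) (S : Finset (d → ℤ))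
    (c : (d → ℤ) → EuclideanSpace ℂ d) (x : UnitAddTorus d) :
    realTrigPoly S (fun k => ((stepSym K Δ (k i) : ℝ) : ℂ) • c k) x =
      ∫ y : UnitAddTorus d, stepKernel i K Δ y • realTrigPoly S c (x - Pi.single i (y i)) := by
  rw [realTrigPoly_apply, trigPoly_axisStep_eq_integral_sub]
  have hint : Integrable (fun y : UnitAddTorus d => (stepKernel i K Δ y : ℂ) • trigPoly S c (x - Pi.single i (y i))) volume :=
    ((Complex.continuous_ofReal.comp (continuous_stepKernel i K Δ)).smul
      ((continuous_trigPoly S c).comp (continuous_const.sub (continuous_pi_single_apply i)))).integrable_of_hasCompactSupport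
      (HasCompactSupport.of_compactSpace _)
  rw [← realPart.integral_comp_comm hint]
  refine integral_congr_ae (ae_of_all _ fun y => ?_)
  dsimp only
  rw [realTrigPoly_apply, Complex.coe_smul, map_smul]

/-- The same with shift `+`. [cite: Grafakos2014, §3.1.3] -/
theorem realTrigPoly_axisStep_eq_integral_add (i : d) (K Δ : ℕ) (S : Finset (d → ℤ))
    (c : (d → ℤ) → EuclideanSpace ℂ d) (x : UnitAddTorus d) :
    realTrigPoly S (fun k => ((stepSym K Δ (k i) : ℝ) : ℂ) • c k) x =
      ∫ y : UnitAddTorus d, stepKernel i K Δ y • realTrigPoly S c (x + Pi.single i (y i)) := by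
  rw [realTrigPoly_apply, trigPoly_axisStep_eq_integral_add]
  have hint : Integrable (fun y : UnitAddTorus d => (stepKernel i K Δ y : ℂ) • trigPoly S c (x + Pi.single i (y i))) volume :=
    ((Complex.continuous_ofReal.comp (continuous_stepKernel i K Δ)).smul
      ((continuous_trigPoly S c).comp (continuous_const.add (continuous_pi_single_apply i)))).integrable_of_hasCompactSupport
      (HasCompactSupport.of_compactSpace _)
  rw [← realPart.integral_comp_comm hint]
  refine integral_congr_ae (ae_of_all _ fun y => ?_)
  dsimp only
  rw [realTrigPoly_apply, Complex.coe_smul, map_smul]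

/-- The centred representative of an axis spike: `‖reprc (yᵢ-spike)‖ = |reprc y _i|`. [cite: Grafakos2014, §3.1.1] -/
theorem norm_reprc_pi_single (i : d) (y : UnitAddTorus d) :
    ‖reprc (Pi.single i (y i) : UnitAddTorus d)‖ = |reprc y i| := by
  have hco : ∀ j, reprc (Pi.single i (y i) : UnitAddTorus d) j = if j = i then reprc y i else 0 := by
    intro j
    rw [reprc_apply_eq_centredCoord, reprc_apply_eq_centredCoord]
    by_cases hj : j = i
    · subst hj; rw [if_pos rfl, Pi.single_eq_same]
    · rw [if_neg hj, Pi.single_eq_of_ne hj]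
      have h0 : ((0 : ℝ) : UnitAddCircle) = 0 := rfl
      rw [← h0, centredCoord_coe (by constructor <;> norm_num)]
  rw [EuclideanSpace.norm_eq, Finset.sum_eq_single i]
  · rw [hco i, if_pos rfl, Real.norm_eq_abs, sq_abs, Real.sqrt_sq_eq_abs]
  · intro j _ hj; rw [hco j, if_neg hj, norm_zero]; ring
  · intro h; exact absurd (Finset.mem_univ i) h

omit [DecidableEq d] in
/-- Cauchy–Schwarz on the torus for a shifted factor: `∫ ‖h(x + a)‖ ‖P(x)‖ ≤ ‖h‖₂ ‖P‖₂`. [folklore] -/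
private theorem integral_norm_shift_mul_norm_le {h P : UnitAddTorus d → EuclideanSpace ℝ d}
    (hh : Continuous h) (hP : Continuous P) (a : UnitAddTorus d) :
    ∫ x, ‖h (x + a)‖ * ‖P x‖ ≤ Real.sqrt (∫ x, ‖h x‖ ^ 2) * Real.sqrt (∫ x, ‖P x‖ ^ 2) := by
  have hha : Continuous fun x => h (x + a) := hh.comp (continuous_add_const a)
  have h1 : MemLp (fun x => ‖h (x + a)‖) (ENNReal.ofReal 2) volume := by
    rw [show ENNReal.ofReal 2 = 2 by norm_num]
    exact (hha.norm.memLp_of_hasCompactSupport (HasCompactSupport.of_compactSpace _) (p := 2))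
  have h2 : MemLp (fun x => ‖P x‖) (ENNReal.ofReal 2) volume := by
    rw [show ENNReal.ofReal 2 = 2 by norm_num]
    exact (hP.norm.memLp_of_hasCompactSupport (HasCompactSupport.of_compactSpace _) (p := 2))
  have hcs := integral_mul_le_Lp_mul_Lq_of_nonneg Real.HolderConjugate.two_two
    (ae_of_all _ fun x => norm_nonneg (h (x + a))) (ae_of_all _ fun x => norm_nonneg (P x)) h1 h2
  have e1 : ∫ x, ‖h (x + a)‖ ^ (2:ℝ) = ∫ x, ‖h x‖ ^ 2 := by
    have := integral_add_right_eq_self (μ := (volume : Measure (UnitAddTorus d))) (fun z => ‖h z‖ ^ (2:ℝ)) a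
    rw [this]
    simp_rw [Real.rpow_two]
  have e2 : ∫ x, ‖P x‖ ^ (2:ℝ) = ∫ x, ‖P x‖ ^ 2 := by simp_rw [Real.rpow_two]
  rw [e1, e2, ← Real.sqrt_eq_rpow, ← Real.sqrt_eq_rpow] at hcs
  exact hcs

/-- **THE COMMUTATOR OF THE AXIS STEP MULTIPLIER WITH A LIPSCHITZ FUNCTION** (pairing form on real trigonometric
polynomials): for `β : T^d → ℝ` continuous with `|β x − β y| ≤ Λ ‖reprc(x − y)‖`, and real trigonometric polynomials
`h = realTrigPoly S c`, `P = realTrigPoly S' c'`,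

  `|∫ β ⟨h, Ψᵢ P⟩ − ∫ β ⟨Ψᵢ h, P⟩| ≤ (2Λ/Δ) · ‖h‖₂ · ‖P‖₂`,

where `Ψᵢ` multiplies coefficients by `stepSym K Δ (kᵢ)` (`‖h‖₂² = Σ_{k∈S} ‖c k‖²`).  Proof: both pairings are double
integrals against the kernel; a translation `x ↦ x + yᵢ-spike` brings them to
`∫ k(y) ∫ (β(x + yᵢ-spike) − β(x)) ⟨h(x + yᵢ-spike), P(x)⟩`, bounded by `Λ · M₁ · ‖h‖₂‖P‖₂` with the first moment
`M₁ ≤ 2/Δ` of `TorusAxisStepKernelMoment`. [cite: DiPernaLions1989, §II.1 Lemma II.1] -/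
theorem abs_axisStep_commutator_pairing_le (i : d) (K : ℕ) {Δ : ℕ} (hΔ : 0 < Δ)
    {β : UnitAddTorus d → ℝ} (hβc : Continuous β) {Λ : ℝ} (hΛ : 0 ≤ Λ)
    (hβL : ∀ x y, |β x - β y| ≤ Λ * ‖reprc (x - y)‖)
    {S S' : Finset (d → ℤ)} (hS : ∀ k ∈ S, -k ∈ S) (hS' : ∀ k ∈ S', -k ∈ S')
    {c c' : (d → ℤ) → EuclideanSpace ℂ d} (hc : IsConjSymm c) (hc' : IsConjSymm c') :
    |(∫ x, β x * ⟪realTrigPoly S c x, realTrigPoly S' (fun k => ((stepSym K Δ (k i) : ℝ) : ℂ) • c' k) x⟫_ℝ) -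
      ∫ x, β x * ⟪realTrigPoly S (fun k => ((stepSym K Δ (k i) : ℝ) : ℂ) • c k) x, realTrigPoly S' c' x⟫_ℝ| ≤
      2 * Λ / Δ * Real.sqrt (∑ k ∈ S, ‖c k‖ ^ 2) * Real.sqrt (∑ k ∈ S', ‖c' k‖ ^ 2) := by
  set h : UnitAddTorus d → EuclideanSpace ℝ d := realTrigPoly S c with hh
  set P : UnitAddTorus d → EuclideanSpace ℝ d := realTrigPoly S' c' with hP
  set kf : UnitAddTorus d → ℝ := stepKernel i K Δ with hkf
  set ι : UnitAddTorus d → UnitAddTorus d := fun y => Pi.single i (y i) with hι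
  have hhc : Continuous h := continuous_realTrigPoly S c
  have hPc : Continuous P := continuous_realTrigPoly S' c'
  have hkc : Continuous kf := continuous_stepKernel i K Δ
  have hιc : Continuous ι := continuous_pi_single_apply i
  obtain ⟨Cβ, hCβ⟩ := (isCompact_univ.image hβc).isBounded.exists_norm_le
  have hCβ' : ∀ x, ‖β x‖ ≤ Cβ := fun x => hCβ _ ⟨x, Set.mem_univ _, rfl⟩
  -- the two pairings as double integrals
  set F1 : UnitAddTorus d × UnitAddTorus d → ℝ := fun p => kf p.2 * (β (p.1 + ι p.2) * ⟪h (p.1 + ι p.2), P p.1⟫_ℝ) with hF1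
  set F2 : UnitAddTorus d × UnitAddTorus d → ℝ := fun p => kf p.2 * (β p.1 * ⟪h (p.1 + ι p.2), P p.1⟫_ℝ) with hF2
  have hF1c : Continuous F1 := by
    have hsh : Continuous fun p : UnitAddTorus d × UnitAddTorus d => p.1 + ι p.2 :=
      continuous_fst.add (hιc.comp continuous_snd)
    exact (hkc.comp continuous_snd).mul ((hβc.comp hsh).mul ((hhc.comp hsh).inner (hPc.comp continuous_fst)))
  have hF2c : Continuous F2 := by
    have hsh : Continuous fun p : UnitAddTorus d × UnitAddTorus d => p.1 + ι p.2 :=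
      continuous_fst.add (hιc.comp continuous_snd)
    exact (hkc.comp continuous_snd).mul ((hβc.comp continuous_fst).mul ((hhc.comp hsh).inner (hPc.comp continuous_fst)))
  have hF1i : Integrable F1 (volume.prod volume) :=
    hF1c.integrable_of_hasCompactSupport (HasCompactSupport.of_compactSpace _)
  have hF2i : Integrable F2 (volume.prod volume) :=
    hF2c.integrable_of_hasCompactSupport (HasCompactSupport.of_compactSpace _)
  -- first pairing
  have hT1 : (∫ x, β x * ⟪h x, realTrigPoly S' (fun k => ((stepSym K Δ (k i) : ℝ) : ℂ) • c' k) x⟫_ℝ) =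
      ∫ y, ∫ x, F1 (x, y) := by
    have step1 : ∀ x, β x * ⟪h x, realTrigPoly S' (fun k => ((stepSym K Δ (k i) : ℝ) : ℂ) • c' k) x⟫_ℝ =
        ∫ y, kf y * (β x * ⟪h x, P (x - ι y)⟫_ℝ) := by
      intro x
      rw [realTrigPoly_axisStep_eq_integral_sub, ← integral_inner, ← integral_const_mul]
      · refine integral_congr_ae (ae_of_all _ fun y => ?_)
        dsimp only
        rw [real_inner_smul_right]; ring
      · exact (hkc.smul (hPc.comp (continuous_const.sub hιc))).integrable_of_hasCompactSupport
          (HasCompactSupport.of_compactSpace _)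
    simp_rw [step1]
    -- swap, then translate `x ↦ x + ι y`
    set G1 : UnitAddTorus d × UnitAddTorus d → ℝ := fun p => kf p.2 * (β p.1 * ⟪h p.1, P (p.1 - ι p.2)⟫_ℝ) with hG1
    have hG1c : Continuous G1 :=
      (hkc.comp continuous_snd).mul ((hβc.comp continuous_fst).mul ((hhc.comp continuous_fst).inner
        (hPc.comp (continuous_fst.sub (hιc.comp continuous_snd)))))
    have hG1i : Integrable G1 (volume.prod volume) :=
      hG1c.integrable_of_hasCompactSupport (HasCompactSupport.of_compactSpace _)
    have hsw := integral_integral_swap (f := fun x y => G1 (x, y)) hG1i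
    simp only [hG1] at hsw
    rw [hsw]
    refine integral_congr_ae (ae_of_all _ fun y => ?_)
    dsimp only
    rw [← integral_add_right_eq_self (fun x => kf y * (β x * ⟪h x, P (x - ι y)⟫_ℝ)) (ι y)]
    refine integral_congr_ae (ae_of_all _ fun x => ?_)
    simp only [hF1, add_sub_cancel_right]
  -- second pairing
  have hT2 : (∫ x, β x * ⟪realTrigPoly S (fun k => ((stepSym K Δ (k i) : ℝ) : ℂ) • c k) x, P x⟫_ℝ) =
      ∫ y, ∫ x, F2 (x, y) := by
    have step1 : ∀ x, β x * ⟪realTrigPoly S (fun k => ((stepSym K Δ (k i) : ℝ) : ℂ) • c k) x, P x⟫_ℝ =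
        ∫ y, kf y * (β x * ⟪h (x + ι y), P x⟫_ℝ) := by
      intro x
      rw [realTrigPoly_axisStep_eq_integral_add, real_inner_comm, ← integral_inner, ← integral_const_mul]
      · refine integral_congr_ae (ae_of_all _ fun y => ?_)
        dsimp only
        rw [real_inner_smul_right, real_inner_comm]; ring
      · exact (hkc.smul (hhc.comp (continuous_const.add hιc))).integrable_of_hasCompactSupport
          (HasCompactSupport.of_compactSpace _)
    simp_rw [step1]
    have hsw := integral_integral_swap (f := fun x y => F2 (x, y)) hF2i
    simp only [hF2] at hsw
    rw [hsw]
  -- the difference, pointwise in `y`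
  have hI1 : Integrable (fun y => ∫ x, F1 (x, y)) volume := hF1i.integral_prod_right
  have hI2 : Integrable (fun y => ∫ x, F2 (x, y)) volume := hF2i.integral_prod_right
  rw [hT1, hT2, ← integral_sub hI1 hI2]
  -- norms of the trigonometric polynomials
  have hnh : Real.sqrt (∫ x, ‖h x‖ ^ 2) = Real.sqrt (∑ k ∈ S, ‖c k‖ ^ 2) := by
    rw [hh, integral_norm_sq_realTrigPoly hS hc]
  have hnP : Real.sqrt (∫ x, ‖P x‖ ^ 2) = Real.sqrt (∑ k ∈ S', ‖c' k‖ ^ 2) := by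
    rw [hP, integral_norm_sq_realTrigPoly hS' hc']
  set Nh : ℝ := Real.sqrt (∑ k ∈ S, ‖c k‖ ^ 2) with hNh
  set NP : ℝ := Real.sqrt (∑ k ∈ S', ‖c' k‖ ^ 2) with hNP
  -- pointwise bound of the `y`-integrand
  have hpt : ∀ y, |(∫ x, F1 (x, y)) - ∫ x, F2 (x, y)| ≤ Λ * Nh * NP * (|reprc y i| * |kf y|) := by
    intro y
    have hF1y : Integrable (fun x => F1 (x, y)) volume :=
      (hF1c.comp (Continuous.prodMk_left y)).integrable_of_hasCompactSupport (HasCompactSupport.of_compactSpace _)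
    have hF2y : Integrable (fun x => F2 (x, y)) volume :=
      (hF2c.comp (Continuous.prodMk_left y)).integrable_of_hasCompactSupport (HasCompactSupport.of_compactSpace _)
    rw [← integral_sub hF1y hF2y]
    have hform : ∀ x, F1 (x, y) - F2 (x, y) = kf y * ((β (x + ι y) - β x) * ⟪h (x + ι y), P x⟫_ℝ) := by
      intro x; simp only [hF1, hF2]; ring
    simp_rw [hform, integral_const_mul, abs_mul]
    -- `|∫ (β(x+ιy) − β x) ⟨h(x+ιy), P x⟩| ≤ Λ |reprc y _i| ‖h‖₂ ‖P‖₂`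
    have hinner : |∫ x, (β (x + ι y) - β x) * ⟪h (x + ι y), P x⟫_ℝ| ≤ Λ * |reprc y i| * (Nh * NP) := by
      have hnorm := norm_integral_le_integral_norm (μ := (volume : Measure (UnitAddTorus d)))
        (fun x => (β (x + ι y) - β x) * ⟪h (x + ι y), P x⟫_ℝ)
      simp only [Real.norm_eq_abs] at hnorm
      refine hnorm.trans ?_
      have hpt' : ∀ x, |(β (x + ι y) - β x) * ⟪h (x + ι y), P x⟫_ℝ| ≤ Λ * |reprc y i| * (‖h (x + ι y)‖ * ‖P x‖) := by
        intro x
        rw [abs_mul]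
        refine mul_le_mul ?_ (abs_real_inner_le_norm _ _) (abs_nonneg _) (by positivity)
        have hb := hβL (x + ι y) x
        rw [add_sub_cancel_left, hι] at hb
        dsimp only at hb
        rw [norm_reprc_pi_single] at hb
        exact hb
      have hgi : Integrable (fun x => Λ * |reprc y i| * (‖h (x + ι y)‖ * ‖P x‖)) volume :=
        (((hhc.comp (continuous_add_const _)).norm.mul hPc.norm).const_mul _).integrable_of_hasCompactSupport
          (HasCompactSupport.of_compactSpace _)
      refine (integral_mono_of_nonneg (ae_of_all _ fun x => abs_nonneg _) hgi (ae_of_all _ hpt')).trans ?_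
      rw [integral_const_mul]
      refine mul_le_mul_of_nonneg_left ?_ (by positivity)
      rw [← hnh, ← hnP]
      exact integral_norm_shift_mul_norm_le hhc hPc (ι y)
    calc |kf y| * |∫ x, (β (x + ι y) - β x) * ⟪h (x + ι y), P x⟫_ℝ|
        ≤ |kf y| * (Λ * |reprc y i| * (Nh * NP)) := mul_le_mul_of_nonneg_left hinner (abs_nonneg _)
      _ = Λ * Nh * NP * (|reprc y i| * |kf y|) := by ring
  -- integrate the pointwise bound against the first moment of the kernel
  have hmom := integral_abs_reprc_mul_abs_stepKernel_le (d := d) i K hΔ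
  have hmi := integrable_abs_reprc_mul_abs_stepKernel (d := d) i K Δ
  have hnorm := norm_integral_le_integral_norm (μ := (volume : Measure (UnitAddTorus d)))
    (fun y => (∫ x, F1 (x, y)) - ∫ x, F2 (x, y))
  simp only [Real.norm_eq_abs] at hnorm
  calc |∫ y, ((∫ x, F1 (x, y)) - ∫ x, F2 (x, y))|
      ≤ ∫ y, |(∫ x, F1 (x, y)) - ∫ x, F2 (x, y)| := hnorm
    _ ≤ ∫ y, Λ * Nh * NP * (|reprc y i| * |kf y|) :=
        integral_mono_of_nonneg (ae_of_all _ fun y => abs_nonneg _) (hmi.const_mul _) (ae_of_all _ hpt)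
    _ = Λ * Nh * NP * ∫ y, |reprc y i| * |kf y| := integral_const_mul _ _
    _ ≤ Λ * Nh * NP * (2 / Δ) := mul_le_mul_of_nonneg_left hmom (by positivity)
    _ = 2 * Λ / Δ * Nh * NP := by ring

end Commutator

end Torus

end Literature.Analysis.FunctionSpaces

end
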